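import Mathlib
import HarnessLib
import HarnessLib.Audit
import Summits.RiemannHypothesis.Statement
import Summits.RiemannHypothesis.RiemannHypothesis.Theorems.Splittings.ScrewLatticeThinWall
import Summits.RiemannHypothesis.RiemannHypothesis.Theorems.Splittings.ScrewLatticePringsheim
import HarnessLib.Audit.Status.Attr

/-!
Route: ScrewMultisection

# Route ScrewMultisection — X-17 SZEGŐ MULTISECTION — eventually PERIODIC signs of Ψ on the lattice
(negativity of any size or density) plus q wall-free rays give RH, via root-of-unity filters and
Pringsheim per class

D-0145 LINE of seat rh-idea-1 (technique: splitting / criterion search; bears_on LADDER-RH rung S-P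
«search for NEW splits (screw §19 ff.)»,
column SCREW §19–20). It suffices to show X = X-17: MultisectionBridge ∧ PeriodicSignsRaysFree ∧
ThinWallOne ⟹ RH, where the PROVABLE
content is the RH-free crux `MultisectionBridge`: for every step h > 0 and period q ≥ 1, if the SIGN
PATTERN of Ψ = zetaScrew on hℕ is
eventually q-periodic (∃ K ∀ k ≥ K: Ψ(kh) < 0 ⟺ Ψ((k+q)h) < 0 — every residue class mod q is
eventually one-signed; Ψ may be negative on
as many classes as it likes, with no size or frequency constraint) and the closed wall
closure(aliasedPoleSet h) misses the q RAYS
{t e^{2πi j/q} : t ∈ [0,1)}, then CEIL(h) = LatticeCeiling h. Mechanism: the ROOT-OF-UNITY FILTER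
F_{q,a}(z) = (1/q) Σ_j ω^{−ja} B_h(ω^j z)
(ω = e^{2πi/q}, B_h the Borel continuation) sums the class sub-series Σ_{k ≡ a} Ψ(kh) z^k near 0 and
is analytic along [0,1) as soon as the q
rotated rays are wall-free (`ScrewBorel.differentiableOn_borel`); each class is eventually
one-signed, so Vivanti–Pringsheim (Literature
`summable_mul_pow_of_nonneg_of_analyticAt`, applied to ±F_{q,a} plus a polynomial correction) pushes
each class radius to 1; summing the q
classes gives |Ψ(kh)| ≤ K_ε e^{ε k}. The conjunct `PeriodicSignsRaysFree` (∃ q ≥ 1: eventually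
q-periodic signs at step 1 ∧ the q rays
wall-free at step 1; RH-implied with q = 1, Sketch6 `periodicSignsRaysFree_of_rh`) — equivalently
«the SIGN SERIES Σ sgn Ψ(k) z^k is a
RATIONAL function», the rational branch of Szegő's 1922 dichotomy for finitely-valued coefficients —
and `ThinWallOne` = TW(1) complete the
split RH ⟺ PeriodicSignsRaysFree(1) ∧ TW(1) through the landed row X-10
`rh_of_latticeCeiling_of_thinWall`. Nothing here bears on the truth of RH.
Lean: `Summit.RiemannHypothesis.RiemannHypothesis.Theses.ScrewMultisection.MultisectionBridge →
Summit.RiemannHypothesis.RiemannHypothesis.Theses.ScrewMultisection.PeriodicSignsRaysFree →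
Summit.RiemannHypothesis.RiemannHypothesis.Theses.ScrewMultisection.ThinWallOne →
Summit.RiemannHypothesis`

## Assembly
Pure logic over the landed row X-10, kernel-checked in the seat folder (Sketch6.lean
`assembly_holds`, 3 lines, rc 0): take q from
PeriodicSignsRaysFree; MultisectionBridge at h = 1 gives LatticeCeiling 1;
`rh_of_latticeCeiling_of_thinWall one_pos` with TW(1) gives RH.
The deciding theorem is `closes (h₁ : MultisectionBridge) (h₂ : PeriodicSignsRaysFree) (h₃ :
ThinWallOne) (hA : Assembly) := hA h₁ h₂ h₃`;
the Assembly item is PROVABLE NOW (proof text attached as evidence at birth).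

Rationale: WHY THIS LINE. Mechanism: X-15 (floor) and X-16 (negativity frequency) still constrain HOW MUCH or
HOW OFTEN Ψ is negative. This line constrains neither: it
asks only that the sign pattern be REGULAR (eventually periodic), and pays on the zero side with
finitely many rays instead of a sector. The
new move is the root-of-unity MULTISECTION of the lattice generating function: the class functions
F_{q,a} are again Borel-type sums whose
singularities are the q rotates ω^{−j}·T_h of the wall, so «q rays wall-free» is exactly «every
F_{q,a} analytic on [0,1)»; and on each class
Ψ is eventually one-signed, so Vivanti–Pringsheim (already in tree, Literature
`summable_mul_pow_of_nonneg_of_analyticAt`; Titchmarsh1939 §7.21,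
Remmert1991) applies to ±F_{q,a}. Szegő's theorem (1922;
[corpus:book:allouche2003-automatic-sequences-theory-applications-generalizations p354]:
a power series with finitely many distinct coefficients is rational or has the unit circle as
natural boundary) names the conjunct: the sign
series of Ψ on ℕ takes values in {−1,0,1}, and «eventually periodic» is precisely its rational
branch. In zero language the q rays are the
residue classes γ ≡ 2πj/q (mod 2π) of off-line ordinates (folded points t e^{2πij/q}) — a FINITE set
of classes, measure zero, versus X-16's
sector. What it does that listed routes do not: the first split whose Ψ-side clause is compatible
with Ψ < 0 on a set of density up to
(q−1)/q; no fact is imported (q applications of the landed Pringsheim lemma). Imported from complex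
analysis: series multisection
(Montgomery–Vaughan use the same filter for characters,
[corpus:book:montgomery2007-multiplicative-number-theory-i-classical-theory p90]) and
Vivanti–Pringsheim; from the tree: `hasSum_latticeGF`, `latticeGF_eq_borel`,
`differentiableOn_borel`, row X-10; BC5 rung = X-15's kernel
`ScrewLatticePringsheim.latticeCeiling_of_floor_of_rayFree` (the q = 1, non-negative-branch corner).

RANKED CRUXES. #2 MultisectionBridge (crux) — RH-free theorem about ζ (the provable content). For
every h > 0 and q ≥ 1: if ∃ K ∀ k ≥ K (Ψ(kh) < 0 ⟺ Ψ((k+q)h) < 0) and for all j and all t ∈ [0,1)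
the point t·e^{2πi j/q} is not in closure(aliasedPoleSet h), then LatticeCeiling h. [difficulty: M]
(why it might fail: Lean cost only: the multisection identity as a HasSum (root-of-unity
orthogonality over Finset.range q, k % q bookkeeping), analyticity of z ↦ B_h(ω^j z) at ray points,
and the polynomial correction of finitely many early terms before Pringsheim. No mathematical gap
known.) [Titchmarsh1939, Remmert1991,
corpus:book:montgomery2007-multiplicative-number-theory-i-classical-theory p90, Suzuki2023]
#3 PeriodicSignsRaysFree (crux) — The conjunct at step 1 (RH-implied, the searchable object; weakest
member of the q-family): there is a period q ≥ 1 such that (Ψ-side) the sign pattern of Ψ(k), k ∈ ℕ,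
is eventually q-periodic (the sign series is rational — Szegő's rational branch) AND (zero-side) no
point t·e^{2πi j/q}, t ∈ [0,1), lies in closure(aliasedPoleSet 1) — in zero language: no off-line
zero has ordinate class −γ ≡ 2πj/q (mod 2π) with folded point inside 𝔻, and no sequence of off-line
zeros has γ_n mod 2π → 2πj/q with deviations converging in (0,1/2]. Under RH it holds with q = 1
(Sketch6 `periodicSignsRaysFree_of_rh`). [difficulty: open-problem] (why it might fail: False iff
¬RH and for EVERY q either the sign pattern of Ψ on ℕ is not eventually q-periodic (generic
almost-periodic oscillation) or a folded off-line zero class reaches one of the q rays; nothing is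
known at step 1.) [Suzuki2023,
corpus:book:allouche2003-automatic-sequences-theory-applications-generalizations p354]
#9 ThinWallOne (support) — TW(1): the closed wall has zero length in 𝔻 (row X-10's hypothesis;
RH-implied, `thinWall_of_rh`). Same text as ScrewFabry.ThinWallOne (shared item expected).
[difficulty: open-problem] [Suzuki2023, corpus:book:ross2002-generalized-analytic-continuation p33]

TWO-LAYER PLAN. MultisectionBridge ⇐ (M1) the filter F_{q,a}(z) = (1/q) Σ_{j<q} ω^{−ja} B_h(ω^j z)
is analytic at every t ∈ [0,1) when the q rays are
wall-free (M⁻) → (M2) multisection germ: HasSum (k ↦ [k ≡ a] Ψ(kh) z^k) (F_{q,a} z) for ‖z‖ <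
e^{−h/2} (M) → (M3) Pringsheim per eventually
one-signed class with polynomial correction ⟹ Σ Ψ(kh) t^k summable on [0,1) (M, hardest) → (M4)
bounded terms ⟹ LatticeCeiling h (S).
Skeleton with the four stubs, the filter defs `borelSum`/`classSum`, and the proved composition
`MultisectionBridge_of` in the seat folder
(bc/Multisection_birth_pre.lean, rc 0, sorries = 4 = stubs).

KILL CRITERIA. A refutation of MultisectionBridge (claimed RH-free theorem) closes the route
`refuted:MultisectionBridge` and would expose an error in
the multisection/germ bookkeeping. A cheap kernel proof of PeriodicSignsRaysFree(1) ⟹ RH would make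
the row a costume (not expected: blind
models satisfy every Ψ-side clause and their circle walls cross every ray). Critic grade «variant of
X-15/X-16» with a STRIKE retires the
line to a remark under X-15.

NOT DECOMPOSED YET. (M1)–(M4) are layer-2 children for the prover. Szegő's natural-boundary branch
(a non-periodic sign series has |z| = 1 as natural boundary)
is a remark about the SIGN series, not about F, and is not an item. Fixed-q members are not filed
separately.

CHEAPEST FALSIFIER. (i) Costume/tautology: `#h21_crux_probe … summit := Summit.RiemannHypothesis` on
MultisectionBridge / PeriodicSignsRaysFree / ThinWallOne
/ Assembly — 4/4 CLEAN before filing (bc/probe6.out; Assembly informational only); BC2 `C → RH`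
probes fail 3/3 (bc/probe6_bc2.lean);
converse RH → PeriodicSignsRaysFree closes (consequence of RH used toward RH — fine). (ii) The
filter algebra by hand: (1/q) Σ_j ω^{j(k−a)} =
[q ∣ k−a]; singularities of z ↦ B_h(ω^j z) are ω^{−j}·T_h, so the ray [0,1) is regular for F_{q,a}
iff the rays ω^{j}[0,1) miss closure T_h
for all j — which is the hypothesis (all j); the class with eventually negative signs is handled by
−F_{q,a}; early terms are a polynomial.
(iii) Instrument row: any negative Ψ(k) is already ¬RH (Suzuki Thm 1.7), so the Ψ-clause is
unfalsifiable by finite data like LP; the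
zero-side clause is refuted only by an off-line zero in one of the q ordinate classes.

NUMBERS. Wall points have norm ≥ e^{−h/2}, so the germ disc ‖z‖ < e^{−h/2} is wall-free for every
rotation; q = 1 is X-15's geometry with the floor
replaced by eventual non-negativity. No hand-picked thresholds (checklist 4c(iv)): q is existential
in the conjunct and universal in the bridge.

DEFINITION REQUESTS. None (the filter `classSum` is a two-line noncomputable def inside the prover's
file; tree decls otherwise).

Novelty: Searches (2026-08-27): lit search --hybrid "Szego theorem power series finitely many different
coefficients rational or natural boundary" (6 docs;
[corpus:book:allouche2003-automatic-sequences-theory-applications-generalizations p354] Carlson 1921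
/ Szegő 1922 statements); lit search --hybrid "series multisection roots of unity filter arithmetic
progression coefficients singularities" (5 docs;
[corpus:book:montgomery2007-multiplicative-number-theory-i-classical-theory p90] root-of-unity
filters; signal-processing texts); lit galaxy search "Szegö|Szegő|natural boundary" --star panama
--title-contains complex ([galaxy:panama:508360919089154] Pólya–Latta Complex Variables — textbook,
no lattice/zeta use); earlier tonight: [corpus:paper:arxiv-0709.2360 p2] (Pringsheim/Fabry), desk
census KEYS-RH-LINES-D0145 / rh-split HANDOFF §17–§21 (no residue-class or sign-periodicity
conjunct); rg 'multisection|roots of unity' over lean/Summits/RiemannHypothesis (none in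
Splittings).
Nearest prior art found: X-15 `route-RiemannHypothesis-ScrewPringsheim` and X-16
`route-RiemannHypothesis-ScrewFabry` (this seat, tonight); Szegő 1922 (via Allouche–Shallit p354);
Vivanti–Pringsheim (Titchmarsh1939 §7.21).
Delta: first split whose Ψ-side clause is a REGULARITY statement (eventually periodic sign pattern =
rational sign series) allowing negativity of any size and any density < 1, priced on the zero side
by finitely many ordinate classes mod 2π; the engine is series multisection + Pringsheim per cl  [refs: book:allouche2003-automatic-sequences-theory-applications-generalizations, book:montgomery2007-multiplicative-number-theory-i-classical-theory, paper:arxiv-0709.2360, Titchmarsh1939]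

Barriers (technique_class: splitting, criterion-search, borel-continuation): - technique_class: splitting, criterion-search, borel-continuation
- Literature.Barriers.RiemannHypothesis.DavenportHeilbronn: outside — no zero-free region or Euler
product; the bridge runs through ζ's explicit-formula dictionary (`latticeGF_eq_borel`, Suzuki2023).
- Literature.Barriers.RiemannHypothesis.BrouckeDebruyneRevesz2023_thm13: outside (Beurling
counterexamples) — no Beurling-prime input; one fixed ℓ¹ Borel family and q real power series.
- Literature.Barriers.RiemannHypothesis.ExceptionalZero: outside — no Dirichlet character (the
root-of-unity filter acts on the summation index k, not on primes), no zero-free region.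
- Literature.Barriers.RiemannHypothesis.BohrDenseValues: outside — no value distribution; the
relevant invisibility results are the tree blind models B14/B16/B16′, honoured: they satisfy every
Ψ-side clause and their one-circle walls cross every ray, so the zero-side clause is what excludes
them; the bridge produces only CEIL, which they have.
- Negatives index: none of stmt-RiemannHypothesis-15969/15970/16980/2575 or the screw-neg landed
negatives (all SIZE floors) is a sign-periodicity or ray statement; nothing refuted is re-wanted.

sub-problem: RiemannHypothesis · status: draft · opened planner-rh-idea-1-g0-0 2026-08-27T22:30:22Z · rev 0 · ledger route-RiemannHypothesis-ScrewMultisection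
GENERATED by the gate from the ledger (D-0016/17). Provers cite these decls: `theorem foo : Summit.RiemannHypothesis.RiemannHypothesis.Theses.ScrewMultisection.<Decl> := …` in Summits/RiemannHypothesis/RiemannHypothesis/Theorems/<Name>.lean.
-/

namespace Summit.RiemannHypothesis.RiemannHypothesis.Theses.ScrewMultisection

open scoped BigOperators Topology Manifold Classical MeasureTheory ProbabilityTheory Matrix InnerProductSpace ComplexConjugate ContinuousMap
open Filter Set Function TopologicalSpace MeasureTheory

attribute [summit_statement] _root_.Summit.RiemannHypothesis

open Summit

/-- item stmt-RiemannHypothesis-23144 · crux · rank 2 · closed · proved by Summit.RiemannHypothesis.RiemannHypothesis.Theorems.Splittings.ScrewLatticeMultisection.multisectionBridge_proof (prover) · by planner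
why it might fail: Lean cost only: the multisection identity as a HasSum (root-of-unity orthogonality over Finset.range q, k % q bookkeeping), analyticity of z ↦ B_h(ω^j z) at ray points, and the polynomial correction of finitely many early terms before Pringsheim. No mathematical gap known.
sources: Titchmarsh1939, Remmert1991, corpus:book:montgomery2007-multiplicative-number-theory-i-classical-theory p90, Suzuki2023
[crux] RH-free theorem about ζ (the provable content). For every h > 0 and q ≥ 1: if ∃ K ∀ k ≥ K
(Ψ(kh) < 0 ⟺ Ψ((k+q)h) < 0) and for all j and all t ∈ [0,1) the point t·e^{2πi j/q} is not in
closure(aliasedPoleSet h), then LatticeCeiling h. [difficulty: M] -/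
@[route_item "route-RiemannHypothesis-ScrewMultisection", crux]
def MultisectionBridge : Prop :=
  ∀ h : ℝ, 0 < h → ∀ q : ℕ, 0 < q → (∃ K : ℕ, ∀ k : ℕ, K ≤ k → (Literature.NumberTheory.LFunctions.zetaScrew (k * h) < 0 ↔ Literature.NumberTheory.LFunctions.zetaScrew ((k + q) * h) < 0)) → (∀ j : ℕ, ∀ t : ℝ, 0 ≤ t → t < 1 → (t : ℂ) * Complex.exp (2 * Real.pi * Complex.I * ((j : ℂ) / (q : ℂ))) ∉ closure (Theorems.Splittings.ScrewLatticeContinuation.aliasedPoleSet h)) → Theorems.Splittings.ScrewLatticeContinuation.LatticeCeiling h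

-- `MultisectionBridge` holds: proved by `Summit.RiemannHypothesis.RiemannHypothesis.Theorems.Splittings.ScrewLatticeMultisection.multisectionBridge_proof` (its module imports this route file, so no `_holds` link can be stated here).

/-- item stmt-RiemannHypothesis-23145 · crux · rank 3 · open · by planner
why it might fail: False iff ¬RH and for EVERY q either the sign pattern of Ψ on ℕ is not eventually q-periodic (generic almost-periodic oscillation) or a folded off-line zero class reaches one of the q rays; nothing is known at step 1.
sources: Suzuki2023, corpus:book:allouche2003-automatic-sequences-theory-applications-generalizations p354
[crux] The conjunct at step 1 (RH-implied, the searchable object; weakest member of the q-family):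
there is a period q ≥ 1 such that (Ψ-side) the sign pattern of Ψ(k), k ∈ ℕ, is eventually q-periodic
(the sign series is rational — Szegő's rational branch) AND (zero-side) no point t·e^{2πi j/q}, t ∈
[0,1), lies in closure(aliasedPoleSet 1) — in zero language: no off-line zero has ordinate class −γ
≡ 2πj/q (mod 2π) with folded point inside 𝔻, and no sequence of off-line zeros has γ_n mod 2π →
2πj/q with deviations converging in (0,1/2]. Under RH it holds with q = 1 (Sketch6
`periodicSignsRaysFree_of_rh`). [difficulty: open-problem] -/
@[route_item "route-RiemannHypothesis-ScrewMultisection", crux]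
def PeriodicSignsRaysFree : Prop :=
  ∃ q : ℕ, 0 < q ∧ (∃ K : ℕ, ∀ k : ℕ, K ≤ k → (Literature.NumberTheory.LFunctions.zetaScrew (k * (1 : ℝ)) < 0 ↔ Literature.NumberTheory.LFunctions.zetaScrew ((k + q) * (1 : ℝ)) < 0)) ∧ (∀ j : ℕ, ∀ t : ℝ, 0 ≤ t → t < 1 → (t : ℂ) * Complex.exp (2 * Real.pi * Complex.I * ((j : ℂ) / (q : ℂ))) ∉ closure (Theorems.Splittings.ScrewLatticeContinuation.aliasedPoleSet 1))

/-- item stmt-RiemannHypothesis-23059 · support · rank 9 · open · by planner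
sources: Suzuki2023, corpus:book:ross2002-generalized-analytic-continuation p33
[support] TW(1): the closed wall has zero length in 𝔻 (row X-10's hypothesis; RH-implied,
`thinWall_of_rh`). [difficulty: open-problem] -/
@[route_item "route-RiemannHypothesis-ScrewMultisection", crux]
def ThinWallOne : Prop :=
  Theorems.Splittings.ScrewLatticeThinWall.ThinWall 1

/-- item stmt-RiemannHypothesis-23146 · assembly · rank 1 · closed · proved by Summit.RiemannHypothesis.RiemannHypothesis.Theorems.ScrewMultisection.assembly_proof (prover) · by planner
sources: Suzuki2023
[assembly] MultisectionBridge → PeriodicSignsRaysFree → ThinWallOne → RH (provable now; proof =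
Sketch6.lean `assembly_holds`). -/
@[route_item "route-RiemannHypothesis-ScrewMultisection", crux]
def Assembly : Prop :=
  MultisectionBridge → PeriodicSignsRaysFree → ThinWallOne → Summit.RiemannHypothesis

-- `Assembly` holds: proved by `Summit.RiemannHypothesis.RiemannHypothesis.Theorems.ScrewMultisection.assembly_proof` (its module imports this route file, so no `_holds` link can be stated here).

/-! D-0027 §2.1 — DECIDING THEOREM (planner-authored via `route open/edit --closes-file`; by planner-rh-idea-1-g0-0 2026-08-27T22:30:23Z):
its hypotheses are this route's items and its conclusion the sub-problem Statement (glue_lint), and it elaborates with this file. -/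

@[closes "route-RiemannHypothesis-ScrewMultisection"] theorem closes (h₁ : MultisectionBridge) (h₂ : PeriodicSignsRaysFree) (h₃ : ThinWallOne)
    (hA : Assembly) : Summit.RiemannHypothesis := hA h₁ h₂ h₃

end Summit.RiemannHypothesis.RiemannHypothesis.Theses.ScrewMultisection
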